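import Literature.NumberTheory.EllipticCurves.FineSelmerTrivialisingRestrictionProofs
import Literature.NumberTheory.EllipticCurves.FineSelmerTorsionCoefficientsFiniteProofs
import HarnessLib

/-!
# Dévissage for the fine Selmer group of a finite module over the cyclotomic tower:
# `Sel₀(K_∞, M)` is finite as soon as the everywhere-unramified homomorphisms on `Gal(K̄/L·K_∞)`
# with values in `M/M′` and in `M′` are finite, for `L/K` finite Galois acting trivially on `M/M′`
# and `M′` (proved; no definition, no named fact, no `sorry`)

`Proofs` file (theorems only) in topic `NumberTheory/EllipticCurves` (namespace
`Literature.NumberTheory.EllipticCurves.FineSelmerDevissage`), written by the prover seat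
`bsd-potss-rkm` g33 (cell `bsd-potss`; item stmt-BirchSwinnertonDyer-19196 `ReducibleKatoMember`,
`--supports`; closes nothing; neither Conjecture A nor BSD is proved for any curve here).

## Why (Coates–Sujatha 2005 Cor. 3.6 / Wuthrich 2014 Lemma 14 on the REDUCIBLE rows)

For `E/ℚ` with `E[p]` reducible the trivialising field `ℚ(E[p])` is in general NOT abelian (non-split
Borel image), so Ferrero–Washington does not feed Coates–Sujatha's Thm. 3.4 directly; the printed remedy
(Lim 2017 Thm. 3.5) ascends Iwasawa's `μ = 0` along the degree-`p` step `ℚ(χ₁,χ₂) ⊂ ℚ(E[p])`. This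
file avoids the ascent: it reads the fine Selmer group of `M = E[p]` on `U = Gal(K̄/L·K_∞)` for the
BOREL field `L = ℚ(χ₁, χ₂)` (abelian), over which `E[p]` is only UNIPOTENT, through the extension
`0 → M′ → M → M/M′ → 0` (`M′ =` the stable line): the `M/M′`-shadow `π ∘ z|_U` of a fine cocycle `z`
is an everywhere-unramified homomorphism, and two fine cocycles with the same shadow, the same values on
coset representatives of `Gal(K_∞/K)`-many... (precisely: of `H/U`, `H = Gal(K̄/K_∞)`) and the same
LOCAL PROFILES at finitely many representatives of the places of `L·K_∞` above the ramified set `S`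
(cyclotomic towers split every prime finitely: tree `forall_resOfLe_conjH1_eq_zero_of_reps`) differ on
`U` by an everywhere-unramified `M′`-valued homomorphism.

## Main statement

`finite_fineSelmerInfty_of_extension`: `K` a number field, `κ` the CYCLOTOMIC `ℤ_p`-extension,
`M` a finite discrete `Γ_K`-module, `π : M → Q` an equivariant additive map to a discrete `Γ_K`-module,
`N ≤ Γ_K` open normal acting trivially on `Q` and on `ker π`, `S` a finite set of places outside which
`M` is unramified (`I_𝔓` acts trivially for `𝔓 ∤ S`). If `Hom(N ∩ H, Q; ∅)` is finite and the
`ker π`-valued members of `Hom(N ∩ H, M; ∅)` are finite (`unramifiedHoms`, everywhere-unramified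
continuous homomorphisms), then `Sel₀(K_∞, M)` (`GreenbergSelmer.fineSelmerInfty`) is finite.
Auxiliaries: `exists_decomp_mul_rep_mul_mem_kerSubgroup` (every `σ ∈ Γ_K` is `δ · τ_i · h` with
`δ ∈ D_v`, `i < p^c`, `h ∈ H` — extracted from the tree's `forall_resOfLe_conjH1_eq_zero_of_reps`),
`exists_eq_smul_sub_of_mem_fineSelmerInfty` (a fine cocycle is a coboundary on `H ∩ D_𝔓` for EVERY
maximal `𝔓`, with an explicit transport of the coboundary element).

References: [CoatesSujatha2005] §3 (Thm. 3.4, Cor. 3.5, Cor. 3.6 and their proofs);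
[Wuthrich2014] Lemma 14; [GreenbergLNM1716] §1, §3; [LimSujatha2018] §3; [SerreGaloisCohomology1997]
I.§2.5, I.§5.1, I.§5.8; [NeukirchANT1999] Ch. I §9.
-/

set_option autoImplicit false

noncomputable section

open scoped Classical Pointwise

namespace Literature.NumberTheory.EllipticCurves.FineSelmerDevissage

open NumberField IsDedekindDomain Field
open Literature.NumberTheory.EllipticCurves Literature.NumberTheory.EllipticCurves.GreenbergSelmer
  Literature.NumberTheory.EllipticCurves.FineSelmerTrivialisingRestriction
  Literature.NumberTheory.EllipticCurves.FineSelmerCoefficientMap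
  Literature.NumberTheory.EllipticCurves.Greenberg1999
  Literature.NumberTheory.GaloisRepresentations

variable {K : Type} [Field K] [NumberField K] {p : ℕ} [Fact p.Prime]

/-! ## §1 Every `σ ∈ Γ_K` is `δ · τ_i · h` (`δ ∈ D_v`, `i < p^c`, `h ∈ Gal(K̄/K_∞)`), `κ` cyclotomic -/

/-- **Finitely many places of `K_∞` above `v`, as a decomposition of `Γ_K`** (cyclotomic `κ`): there is
`c` such that for every choice of `τ i ∈ Γ_K` with `κ(τ i) = i`, every `σ ∈ Γ_K` is `δ · τ i · h` with
`δ ∈ D_v`, `i < p^c` and `h ∈ H = ker κ` — `κ(D_v)` is a closed subgroup of `ℤ_p` containing a non-zero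
element (`exists_apply_resGal_ne_one_of_isCyclotomic`), hence `⊇ p^c ℤ_p`. (The argument of the tree's
`forall_resOfLe_conjH1_eq_zero_of_reps`, recorded as a statement about group elements.)
[cite: GreenbergLNM1716, §1 ("every non-archimedean prime is finitely decomposed in F_∞/F")]
[cite: Washington1997, §13.1] -/
theorem exists_decomp_mul_rep_mul_mem_kerSubgroup (κ : ZpExtension K p) (hκ : κ.IsCyclotomic)
    (v : HeightOneSpectrum (𝓞 K)) :
    ∃ c : ℕ, ∀ (τ : ℕ → absoluteGaloisGroup K),
      (∀ i, κ (τ i) = Multiplicative.ofAdd ((i : ℕ) : ℤ_[p])) →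
      ∀ σ : absoluteGaloisGroup K, ∃ δ ∈ decomp v, ∃ i < p ^ c, ∃ h ∈ κ.kerSubgroup,
        σ = δ * τ i * h := by
  obtain ⟨σv, hσv⟩ := exists_apply_resGal_ne_one_of_isCyclotomic hκ v
  set u : ℤ_[p] := (κ (resGal (K := K) (v.adicCompletion K) σv)).toAdd with hudef
  have hu0 : u ≠ 0 := fun h ↦ hσv (Multiplicative.toAdd.injective h)
  let Z : AddSubgroup ℤ_[p] :=
    AddSubgroup.toSubgroup.symm ((decomp v).map
      (κ.toContinuousMonoidHom : absoluteGaloisGroup K →* Multiplicative ℤ_[p]))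
  have hZmem : ∀ y : ℤ_[p], y ∈ Z ↔ ∃ δ ∈ decomp v, κ δ = Multiplicative.ofAdd y := fun y ↦ by
    change Multiplicative.ofAdd y ∈ (decomp v).map _ ↔ _
    rw [Subgroup.mem_map]
    rfl
  have hZclosed : IsClosed (Z : Set ℤ_[p]) := by
    have hc : IsCompact (((decomp v).map
        (κ.toContinuousMonoidHom : absoluteGaloisGroup K →* Multiplicative ℤ_[p]) :
        Subgroup (Multiplicative ℤ_[p])) : Set (Multiplicative ℤ_[p])) := by
      rw [Subgroup.coe_map]
      exact (Kobayashi2003.isCompact_decomp v).image κ.toContinuousMonoidHom.continuous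
    exact hc.isClosed
  have huZ : u ∈ Z := (hZmem u).mpr ⟨_, (mem_decomp_iff v _).mpr ⟨σv, rfl⟩, rfl⟩
  refine ⟨u.valuation, fun τ hτ σ ↦ ?_⟩
  set c := u.valuation with hc
  set y : ℤ_[p] := (κ σ).toAdd with hy
  set i : ℕ := (PadicInt.toZModPow c y).val with hi
  have hi_lt : i < p ^ c := ZMod.val_lt _
  have hyi : y - i ∈ Ideal.span {(p : ℤ_[p]) ^ c} := by
    rw [← PadicInt.ker_toZModPow, RingHom.mem_ker, map_sub, map_natCast, hi, ZMod.natCast_zmod_val,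
      sub_self]
  obtain ⟨z, hz⟩ := Ideal.mem_span_singleton.mp hyi
  obtain ⟨δ, hδD, hδ⟩ := (hZmem _).mp (hz ▸ pow_valuation_mul_mem_of_isClosed Z hZclosed huZ hu0 z :
    y - i ∈ Z)
  have hh : (δ * τ i)⁻¹ * σ ∈ κ.kerSubgroup := by
    rw [ZpExtension.mem_kerSubgroup, map_mul, map_inv, map_mul, hδ, hτ i]
    apply Multiplicative.toAdd.injective
    rw [toAdd_mul, toAdd_inv, toAdd_mul, toAdd_ofAdd, toAdd_ofAdd, toAdd_one, ← hy]
    ring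
  exact ⟨δ, hδD, i, hi_lt, (δ * τ i)⁻¹ * σ, hh, by group⟩

/-! ## §2 A fine cocycle is a coboundary on `H ∩ D_𝔓` for EVERY maximal `𝔓` -/

section Local

variable (κ : ZpExtension K p)
variable {M : Type} [AddCommGroup M] [DistribMulAction (absoluteGaloisGroup K) M]
  [TopologicalSpace M] [DiscreteTopology M]

/-- **The fine local condition at an arbitrary prime.** If the class of the cocycle `z : H → M`
(`H = Gal(K̄/K_∞)`) lies in `Sel₀(K_∞, M)`, then for every maximal ideal `𝔓` of `\bar ℤ_K` there is
`a ∈ M` with `z(x) = x • a − a` for all `x ∈ H ∩ D_𝔓`: the decomposition group of `𝔓` is `g D_v g⁻¹`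
for the chosen `D_v` (`exists_conj_mem_decomp_of_mem_decompositionSubgroup`), the fine condition for the
conjugate class `conj_{g⁻¹} [z]` at `v` gives `g⁻¹ • z(g y g⁻¹) = y • a − a` on `H ∩ D_v`, and then
`z(x) = x • (g • a) − g • a`. [cite: CoatesSujatha2005, §3 (definition of R(E/F_∞): locally trivial at every place)]
[cite: SerreGaloisCohomology1997, I.§2.5] -/
theorem exists_eq_smul_sub_of_mem_fineSelmerInfty
    (z : contOneCocycles (discreteTopRep κ.kerSubgroup M))
    (hz : oneCocycleClass _ z ∈ fineSelmerInfty M κ)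
    (𝔓 : Ideal (absIntegers (𝓞 K) K)) [𝔓.IsMaximal] :
    ∃ a : M, ∀ x : κ.kerSubgroup,
      (x : absoluteGaloisGroup K) ∈ 𝔓.decompositionSubgroup (absoluteGaloisGroup K) →
        z.1 x = (x : absoluteGaloisGroup K) • a - a := by
  obtain ⟨v, g, hg⟩ := exists_conj_mem_decomp_of_mem_decompositionSubgroup 𝔓
  have hloc := ((mem_fineSelmerInfty_iff_resOfLe κ _).1 hz).1 v g⁻¹
  obtain ⟨a, ha⟩ := (CocycleCriteria.conjH1_oneCocycleClass_mem_ker_resOfLe_iff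
    (inf_le_left : κ.kerSubgroup ⊓ decomp v ≤ κ.kerSubgroup) g⁻¹ z).1 hloc
  refine ⟨g • a, fun x hx ↦ ?_⟩
  have hxD : g⁻¹ * (x : absoluteGaloisGroup K) * g ∈ decomp v := hg _ hx
  have hxH : g⁻¹ * (x : absoluteGaloisGroup K) * g ∈ κ.kerSubgroup := by
    simpa only [inv_inv] using (inferInstance : κ.kerSubgroup.Normal).conj_mem _ x.2 g⁻¹
  have h := ha ⟨g⁻¹ * (x : absoluteGaloisGroup K) * g, Subgroup.mem_inf.2 ⟨hxH, hxD⟩⟩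
  have hconj : subgroupConj κ.kerSubgroup g⁻¹
      (Subgroup.inclusion (inf_le_left : κ.kerSubgroup ⊓ decomp v ≤ κ.kerSubgroup)
        ⟨g⁻¹ * (x : absoluteGaloisGroup K) * g, Subgroup.mem_inf.2 ⟨hxH, hxD⟩⟩) = x := by
    apply Subtype.ext
    simp only [subgroupConj_apply_coe, Subgroup.coe_inclusion, inv_inv]
    group
  rw [hconj] at h
  have h2 : z.1 x = g • ((g⁻¹ * (x : absoluteGaloisGroup K) * g) • a - a) := by
    rw [← h, smul_inv_smul]
  rw [h2, smul_sub, smul_smul, ← mul_assoc, ← mul_assoc, mul_inv_cancel, one_mul, mul_smul]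

/-- `x ∈ I_{ρ • 𝔓} ⟹ ρ⁻¹ x ρ ∈ I_𝔓`. [cite: NeukirchANT1999, Ch. I §9, after (9.5) and Prop. (9.6)] -/
theorem conj_mem_inertia_of_mem_inertia_smul {S : Type*} [CommRing S] {G : Type*} [Group G]
    [MulSemiringAction G S] (𝔓 : Ideal S) (ρ : G) {x : G} (hx : x ∈ (ρ • 𝔓).inertia G) :
    ρ⁻¹ * x * ρ ∈ 𝔓.inertia G := by
  intro y
  change (ρ⁻¹ * x * ρ) • y - y ∈ 𝔓
  have h := hx (ρ • y)
  change x • ρ • y - ρ • y ∈ ρ • 𝔓 at h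
  rw [Ideal.mem_pointwise_smul_iff_inv_smul_mem, smul_sub, inv_smul_smul] at h
  rwa [mul_smul, mul_smul]

end Local

/-! ## §3 The dévissage -/

section Main

variable (κ : ZpExtension K p)
variable {M : Type} [AddCommGroup M] [DistribMulAction (absoluteGaloisGroup K) M]
  [TopologicalSpace M] [DiscreteTopology M]
variable {Q : Type} [AddCommGroup Q] [DistribMulAction (absoluteGaloisGroup K) Q]
  [TopologicalSpace Q]

/-- **Dévissage for `Sel₀(K_∞, M)` along `0 → ker π → M → Q`.** Let `K` be a number field, `κ` its
CYCLOTOMIC `ℤ_p`-extension (`H = Gal(K̄/K_∞)`), `M` a finite discrete `Γ_K`-module, `π : M → Q` a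
`Γ_K`-equivariant additive map to a discrete `Γ_K`-module, `N ≤ Γ_K` an OPEN NORMAL subgroup acting
trivially on `Q` and on `ker π` (`N = Gal(K̄/L)`), and `S` a finite set of finite places such that every
inertia group `I_𝔓`, `𝔓 ∤ S`, acts trivially on `M`. If the everywhere-unramified continuous
homomorphisms `Hom(N ∩ H, Q; ∅)` are finite and the `ker π`-valued members of `Hom(N ∩ H, M; ∅)` are
finite, then `Sel₀(K_∞, M)` is finite. Proof: a cocycle `z` on `H` with fine class is recorded by
(i) its `Q`-shadow `π ∘ z|_{N ∩ H} ∈ Hom(N ∩ H, Q; ∅)`, (ii) its values on representatives of the finite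
`H/(N ∩ H)`, (iii) its local profiles `x ↦ g • z(g⁻¹ x g)` on `H ∩ D_v` for `v ∈ S` and the finitely
many `g = τ_i r_j⁻¹` (`κ(τ_i) = i < p^c`, `r_j` the representatives) — each a coboundary `x ↦ x•a − a`,
`a ∈ M`; two fine cocycles with the same record differ on `N ∩ H` by a `ker π`-valued
everywhere-unramified homomorphism (every prime above `v ∈ S` is `u g⁻¹ 𝔓₀(v)` with `u ∈ N ∩ H`, by
`exists_decomp_mul_rep_mul_mem_kerSubgroup`), and a cocycle is determined by (ii) and its restriction to
`N ∩ H`. [cite: CoatesSujatha2005, §3 (proofs of Thm. 3.4 and Cor. 3.6)] [cite: Wuthrich2014, Lemma 14]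
[cite: SerreGaloisCohomology1997, I.§5.8 (inflation–restriction)] -/
theorem finite_fineSelmerInfty_of_extension [Finite M] (hκ : κ.IsCyclotomic)
    (π : M →+ Q) (hπ : ∀ (σ : absoluteGaloisGroup K) (m : M), π (σ • m) = σ • π m)
    (N : Subgroup (absoluteGaloisGroup K)) [N.Normal]
    (hNopen : IsOpen (N : Set (absoluteGaloisGroup K)))
    (hNQ : ∀ σ ∈ N, ∀ q : Q, σ • q = q) (hNC : ∀ σ ∈ N, ∀ m : M, π m = 0 → σ • m = m)
    (S : Set (HeightOneSpectrum (𝓞 K))) (hS : S.Finite)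
    (hunr : ∀ v ∉ S, ∀ 𝔓 ∈ v.primesAbove, ∀ σ ∈ 𝔓.inertia (absoluteGaloisGroup K),
      ∀ m : M, σ • m = m)
    (hQfin : (unramifiedHoms (N ⊓ κ.kerSubgroup) Q (∅ : Set (HeightOneSpectrum (𝓞 K)))).Finite)
    (hCfin : {f ∈ unramifiedHoms (N ⊓ κ.kerSubgroup) M (∅ : Set (HeightOneSpectrum (𝓞 K))) |
      ∀ u, π (f u) = 0}.Finite) :
    (fineSelmerInfty M κ : Set (subgroupH1 κ.kerSubgroup M)).Finite := by
  have hp : p.Prime := Fact.out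
  set H := κ.kerSubgroup with hHdef
  set U : Subgroup (absoluteGaloisGroup K) := N ⊓ H with hUdef
  have hUH : U ≤ H := inf_le_right
  have hUN : U ≤ N := inf_le_left
  set V : Subgroup H := U.subgroupOf H with hVdef
  -- `V` is open in the compact group `H`, so `H/V` is finite
  haveI : CompactSpace H := isCompact_iff_compactSpace.mp κ.isClosed_kerSubgroup.isCompact
  have hVopen : IsOpen (V : Set H) := by
    have : (V : Set H) = Subtype.val ⁻¹' (N : Set (absoluteGaloisGroup K)) := by
      ext x
      simp only [hVdef, hUdef, SetLike.mem_coe, Subgroup.mem_subgroupOf, Subgroup.mem_inf,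
        Set.mem_preimage]
      exact ⟨fun h ↦ h.1, fun h ↦ ⟨h, x.2⟩⟩
    rw [this]
    exact hNopen.preimage continuous_subtype_val
  haveI hfinHV : Finite (H ⧸ V) := Subgroup.quotient_finite_of_isOpen V hVopen
  -- `U` is normal in `Γ_K`
  have hUconj : ∀ (g : absoluteGaloisGroup K) {u : absoluteGaloisGroup K}, u ∈ U →
      g * u * g⁻¹ ∈ U := fun g u hu ↦
    Subgroup.mem_inf.2 ⟨(inferInstance : N.Normal).conj_mem _ (Subgroup.mem_inf.1 hu).1 g,
      (inferInstance : H.Normal).conj_mem _ (Subgroup.mem_inf.1 hu).2 g⟩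
  -- representatives: `c`, `τ`
  have hreps := fun v : HeightOneSpectrum (𝓞 K) ↦ exists_decomp_mul_rep_mul_mem_kerSubgroup κ hκ v
  choose cv hcv using hreps
  let c : ℕ := hS.toFinset.sup cv
  have hτex : ∀ i : ℕ, ∃ τ : absoluteGaloisGroup K, κ τ = Multiplicative.ofAdd ((i : ℕ) : ℤ_[p]) :=
    fun i ↦ κ.surjective _
  choose τ hτ using hτex
  -- the conjugating elements `g(i, q) = τ i · (q.out)⁻¹`
  let gι : ℕ → (H ⧸ V) → absoluteGaloisGroup K :=
    fun i q ↦ τ i * ((q.out : H) : absoluteGaloisGroup K)⁻¹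
  have hconjH : ∀ (g : absoluteGaloisGroup K) (x : H), g⁻¹ * (x : absoluteGaloisGroup K) * g ∈ H :=
    fun g x ↦ by simpa only [inv_inv] using (inferInstance : H.Normal).conj_mem _ x.2 g⁻¹
  -- the index type of local profiles
  let Idx : Type := ↥hS.toFinset × Fin (p ^ c) × (H ⧸ V)
  -- the records
  let Λ : contOneCocycles (discreteTopRep H M) → (U → M) := fun z u ↦ z.1 ⟨u, hUH u.2⟩
  let πΛ : contOneCocycles (discreteTopRep H M) → (U → Q) := fun z u ↦ π (z.1 ⟨u, hUH u.2⟩)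
  let qv : contOneCocycles (discreteTopRep H M) → ((H ⧸ V) → M) := fun z q ↦ z.1 q.out
  let P : contOneCocycles (discreteTopRep H M) → Idx → H → M := fun z idx x ↦
    if (x : absoluteGaloisGroup K) ∈ decomp (idx.1 : HeightOneSpectrum (𝓞 K)) then
      gι idx.2.1 idx.2.2 • z.1 ⟨(gι idx.2.1 idx.2.2)⁻¹ * x * gι idx.2.1 idx.2.2,
        hconjH (gι idx.2.1 idx.2.2) x⟩
    else 0
  let cob : Idx → M → H → M := fun idx a x ↦
    if (x : absoluteGaloisGroup K) ∈ decomp (idx.1 : HeightOneSpectrum (𝓞 K)) then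
      (x : absoluteGaloisGroup K) • a - a else 0
  let Θ : contOneCocycles (discreteTopRep H M) → (U → Q) × ((H ⧸ V) → M) × (Idx → H → M) :=
    fun z ↦ (πΛ z, qv z, P z)
  set Z0 : Set (contOneCocycles (discreteTopRep H M)) :=
    {z | oneCocycleClass _ z ∈ fineSelmerInfty M κ} with hZ0
  -- the cocycle identity, with the ambient action displayed
  have hcoc : ∀ (z : contOneCocycles (discreteTopRep H M)) (a b : H),
      z.1 (a * b) = z.1 a + (a : absoluteGaloisGroup K) • z.1 b := fun z a b ↦ z.2 a b
  ------------------------------------------------------------------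
  -- (F1) the `Q`-shadow is an everywhere-unramified homomorphism
  have hF1 : ∀ z ∈ Z0, πΛ z ∈ unramifiedHoms U Q (∅ : Set (HeightOneSpectrum (𝓞 K))) := by
    intro z hz
    refine ⟨?_, fun a b ↦ ?_, fun v _ 𝔓 h𝔓 u hu ↦ ?_⟩
    · exact (continuous_of_discreteTopology (f := π)).comp
        (z.1.continuous.comp (continuous_subtype_val.subtype_mk _))
    · have hab : (⟨((a * b : U) : absoluteGaloisGroup K), hUH (a * b).2⟩ : H) =
          ⟨(a : absoluteGaloisGroup K), hUH a.2⟩ * ⟨(b : absoluteGaloisGroup K), hUH b.2⟩ := rfl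
      show π (z.1 _) = π (z.1 _) + π (z.1 _)
      rw [hab, hcoc, map_add, hπ, hNQ _ (hUN a.2)]
    · haveI := HeightOneSpectrum.isMaximal_of_mem_primesAbove h𝔓
      obtain ⟨a, ha⟩ := exists_eq_smul_sub_of_mem_fineSelmerInfty κ z hz 𝔓
      have h := ha ⟨(u : absoluteGaloisGroup K), hUH u.2⟩
        (Ideal.inertia_le_decompositionSubgroup _ _ hu)
      show π (z.1 _) = 0
      rw [h, map_sub, hπ, hNQ _ (hUN u.2), sub_self]
  ------------------------------------------------------------------
  -- (F2) the local profiles are coboundaries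
  have hF2 : ∀ z ∈ Z0, P z ∈ Set.univ.pi fun idx ↦ Set.range (cob idx) := by
    intro z hz
    rw [Set.mem_univ_pi]
    rintro ⟨v, i, q⟩
    have hloc := ((mem_fineSelmerInfty_iff_resOfLe κ _).1 hz).1 (v : HeightOneSpectrum (𝓞 K))
      (gι i q)
    obtain ⟨a, ha⟩ := (CocycleCriteria.conjH1_oneCocycleClass_mem_ker_resOfLe_iff
      (inf_le_left : H ⊓ decomp (v : HeightOneSpectrum (𝓞 K)) ≤ H) (gι i q) z).1 hloc
    refine ⟨a, funext fun x ↦ ?_⟩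
    by_cases hx : (x : absoluteGaloisGroup K) ∈ decomp (v : HeightOneSpectrum (𝓞 K))
    · have h := ha ⟨x, Subgroup.mem_inf.2 ⟨x.2, hx⟩⟩
      simp only [cob, P, hx, if_true]
      exact h.symm
    · simp only [cob, P, hx, if_false]
  ------------------------------------------------------------------
  -- (F3) two fine cocycles with the same record differ on `U` by a `ker π`-valued unramified hom
  have hF3 : ∀ z₁ ∈ Z0, ∀ z₂ ∈ Z0, Θ z₁ = Θ z₂ →
      (fun u ↦ Λ z₁ u - Λ z₂ u) ∈ {f ∈ unramifiedHoms U M (∅ : Set (HeightOneSpectrum (𝓞 K))) |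
        ∀ u, π (f u) = 0} := by
    intro z₁ hz₁ z₂ hz₂ hΘ
    obtain ⟨hΘ1, hΘ23⟩ := Prod.ext_iff.1 hΘ
    obtain ⟨hΘ2, hΘ3⟩ := Prod.ext_iff.1 hΘ23
    set f : U → M := fun u ↦ Λ z₁ u - Λ z₂ u with hfdef
    -- values in `ker π`
    have hfπ : ∀ u, π (f u) = 0 := fun u ↦ by
      have h := congrFun hΘ1 u
      show π (z₁.1 _ - z₂.1 _) = 0
      rw [map_sub, sub_eq_zero]
      exact h
    -- additivity
    have hfadd : ∀ a b : U, f (a * b) = f a + f b := by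
      intro a b
      have hab : (⟨((a * b : U) : absoluteGaloisGroup K), hUH (a * b).2⟩ : H) =
          ⟨(a : absoluteGaloisGroup K), hUH a.2⟩ * ⟨(b : absoluteGaloisGroup K), hUH b.2⟩ := rfl
      have hfix : (a : absoluteGaloisGroup K) • f b = f b := hNC _ (hUN a.2) _ (hfπ b)
      show z₁.1 _ - z₂.1 _ = (z₁.1 _ - z₂.1 _) + (z₁.1 _ - z₂.1 _)
      rw [hab, hcoc, hcoc]
      have hfix' : (a : absoluteGaloisGroup K) • (z₁.1 ⟨(b : absoluteGaloisGroup K), hUH b.2⟩ -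
          z₂.1 ⟨(b : absoluteGaloisGroup K), hUH b.2⟩) =
          z₁.1 ⟨(b : absoluteGaloisGroup K), hUH b.2⟩ - z₂.1 ⟨(b : absoluteGaloisGroup K), hUH b.2⟩ :=
        hfix
      rw [smul_sub] at hfix'
      rw [← hfix']
      abel
    have hf1 : f 1 = 0 := by
      have h := hfadd 1 1
      rw [mul_one, left_eq_add] at h
      exact h
    have hfinv : ∀ a : U, f a⁻¹ = -f a := fun a ↦ by
      have h := hfadd a a⁻¹
      rw [mul_inv_cancel, hf1] at h
      exact (neg_eq_of_add_eq_zero_right h.symm).symm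
    have hfconj : ∀ a b : U, f (a⁻¹ * b * a) = f b := fun a b ↦ by
      rw [hfadd, hfadd, hfinv, neg_add_cancel_comm]
    -- continuity
    have hfcont : Continuous f :=
      (continuous_of_discreteTopology (f := fun x : M × M ↦ x.1 - x.2)).comp
        ((z₁.1.continuous.comp (continuous_subtype_val.subtype_mk _)).prodMk
          (z₂.1.continuous.comp (continuous_subtype_val.subtype_mk _)))
    refine ⟨⟨hfcont, hfadd, fun v _ 𝔓 h𝔓 u hu ↦ ?_⟩, hfπ⟩
    haveI := HeightOneSpectrum.isMaximal_of_mem_primesAbove h𝔓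
    by_cases hvS : v ∈ S
    swap
    · -- unramified place: both cocycles vanish at `u`
      obtain ⟨a₁, ha₁⟩ := exists_eq_smul_sub_of_mem_fineSelmerInfty κ z₁ hz₁ 𝔓
      obtain ⟨a₂, ha₂⟩ := exists_eq_smul_sub_of_mem_fineSelmerInfty κ z₂ hz₂ 𝔓
      have huD := Ideal.inertia_le_decompositionSubgroup _ _ hu
      show z₁.1 _ - z₂.1 _ = 0
      rw [ha₁ ⟨(u : absoluteGaloisGroup K), hUH u.2⟩ huD,
        ha₂ ⟨(u : absoluteGaloisGroup K), hUH u.2⟩ huD, hunr v hvS 𝔓 h𝔓 _ hu,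
        hunr v hvS 𝔓 h𝔓 _ hu, sub_self, sub_self, sub_self]
    · -- ramified place: use the profile at the right representative
      obtain ⟨ρ, hρ⟩ := HeightOneSpectrum.exists_smul_eq_of_mem_primesAbove_holds
        (adicCompletionPrime_mem_primesAbove K v) h𝔓
      obtain ⟨δ₁, hδ₁, i, hi, h, hh, hdec⟩ := hcv v τ hτ ρ⁻¹
      set q : H ⧸ V := QuotientGroup.mk ⟨h⁻¹, H.inv_mem hh⟩ with hqdef
      obtain ⟨w, hw⟩ := QuotientGroup.mk_out_eq_mul V (⟨h⁻¹, H.inv_mem hh⟩ : H)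
      set r : absoluteGaloisGroup K := ((q.out : H) : absoluteGaloisGroup K) with hrdef
      have hwU : ((w : H) : absoluteGaloisGroup K) ∈ U := Subgroup.mem_subgroupOf.1 w.2
      have hvS' : v ∈ hS.toFinset := hS.mem_toFinset.2 hvS
      have hic : i < p ^ c :=
        lt_of_lt_of_le hi (Nat.pow_le_pow_right hp.pos (Finset.le_sup (f := cv) hvS'))
      let idx : Idx := (⟨v, hvS'⟩, ⟨i, hic⟩, q)
      set g : absoluteGaloisGroup K := τ i * r⁻¹ with hgdef
      have hgι : gι i q = g := rfl
      -- `h⁻¹ = r · w⁻¹`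
      have hr : h⁻¹ = r * ((w : H) : absoluteGaloisGroup K)⁻¹ := by
        have h1 := congrArg (fun x : H ↦ (x : absoluteGaloisGroup K)) hw
        simp only [Subgroup.coe_mul] at h1
        rw [hrdef, hqdef, h1, mul_inv_cancel_right]
      set u₀ : absoluteGaloisGroup K := r * ((w : H) : absoluteGaloisGroup K)⁻¹ * r⁻¹ with hu₀def
      have hu₀ : u₀ ∈ U := hUconj r (U.inv_mem hwU)
      have hρ' : ρ = u₀ * g⁻¹ * δ₁⁻¹ := by
        have : ρ = h⁻¹ * (τ i)⁻¹ * δ₁⁻¹ := by rw [← inv_inv ρ, hdec]; group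
        rw [this, hr, hu₀def, hgdef]
        group
      -- `ρ⁻¹ u ρ ∈ I_{𝔓₀(v)} ≤ D_v`, hence `g (u₀⁻¹ u u₀) g⁻¹ = δ₁⁻¹ (ρ⁻¹ u ρ) δ₁ ∈ D_v`
      have hu' : (u : absoluteGaloisGroup K) ∈
          (ρ • adicCompletionPrime K v).inertia (absoluteGaloisGroup K) := by
        rw [hρ]; exact hu
      have hy0 : ρ⁻¹ * (u : absoluteGaloisGroup K) * ρ ∈
          (adicCompletionPrime K v).inertia (absoluteGaloisGroup K) :=
        conj_mem_inertia_of_mem_inertia_smul _ _ hu'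
      have hy0D : ρ⁻¹ * (u : absoluteGaloisGroup K) * ρ ∈ decomp v := by
        have h1 := Ideal.inertia_le_decompositionSubgroup _ _ hy0
        rw [decompositionSubgroup_adicCompletionPrime_eq_range] at h1
        exact h1
      set y : absoluteGaloisGroup K := u₀⁻¹ * (u : absoluteGaloisGroup K) * u₀ with hydef
      have hyU : y ∈ U := U.mul_mem (U.mul_mem (U.inv_mem hu₀) u.2) hu₀
      have hxeq : g * y * g⁻¹ = δ₁⁻¹ * (ρ⁻¹ * (u : absoluteGaloisGroup K) * ρ) * δ₁ := by
        rw [hydef, hρ']; group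
      have hxD : g * y * g⁻¹ ∈ decomp v := by
        rw [hxeq]
        exact (decomp v).mul_mem ((decomp v).mul_mem ((decomp v).inv_mem hδ₁) hy0D) hδ₁
      have hxH : g * y * g⁻¹ ∈ H := (inferInstance : H.Normal).conj_mem _ (hUH hyU) g
      -- evaluate the profile equality at `x = g y g⁻¹`
      have hP : P z₁ = P z₂ := hΘ3
      have hPeq : P z₁ idx ⟨g * y * g⁻¹, hxH⟩ = P z₂ idx ⟨g * y * g⁻¹, hxH⟩ := by
        rw [hP]
      have hxD' : ((⟨g * y * g⁻¹, hxH⟩ : H) : absoluteGaloisGroup K) ∈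
          decomp ((idx.1 : HeightOneSpectrum (𝓞 K))) := hxD
      simp only [P, hxD', if_true] at hPeq
      have hPeq' : z₁.1 ⟨g⁻¹ * (g * y * g⁻¹) * g, hconjH g ⟨g * y * g⁻¹, hxH⟩⟩ =
          z₂.1 ⟨g⁻¹ * (g * y * g⁻¹) * g, hconjH g ⟨g * y * g⁻¹, hxH⟩⟩ :=
        MulAction.injective g hPeq
      have hyy : (⟨g⁻¹ * (g * y * g⁻¹) * g, hconjH g ⟨g * y * g⁻¹, hxH⟩⟩ : H) = ⟨y, hUH hyU⟩ :=
        Subtype.ext (by simp only; group)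
      rw [hyy] at hPeq'
      -- `f y = 0`, hence `f u = 0`
      have hfy : f ⟨y, hyU⟩ = 0 := by
        show z₁.1 _ - z₂.1 _ = 0
        rw [sub_eq_zero]
        exact hPeq'
      have huy : (u : U) = (⟨u₀, hu₀⟩ : U)⁻¹⁻¹ * ⟨y, hyU⟩ * (⟨u₀, hu₀⟩ : U)⁻¹ := by
        apply Subtype.ext
        simp only [inv_inv, Subgroup.coe_mul, Subgroup.coe_inv, hydef]
        group
      rw [huy, hfconj, hfy]
  ------------------------------------------------------------------
  -- (F4) a cocycle is determined by its restriction to `U` and its values on representatives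
  have hF4 : Function.Injective fun z : contOneCocycles (discreteTopRep H M) ↦ (Λ z, qv z) := by
    intro z z' hzz'
    simp only [Prod.mk.injEq] at hzz'
    obtain ⟨hΛ, hq⟩ := hzz'
    apply Subtype.ext
    ext x
    obtain ⟨w, hw⟩ := QuotientGroup.mk_out_eq_mul V x
    have hx : x = (QuotientGroup.mk x : H ⧸ V).out * ((w⁻¹ : V) : H) := by
      rw [hw, Subgroup.coe_inv, mul_inv_cancel_right]
    have hwU : (((w⁻¹ : V) : H) : absoluteGaloisGroup K) ∈ U := Subgroup.mem_subgroupOf.1 (w⁻¹).2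
    have h1 : z.1 ((w⁻¹ : V) : H) = z'.1 ((w⁻¹ : V) : H) :=
      congrFun hΛ ⟨(((w⁻¹ : V) : H) : absoluteGaloisGroup K), hwU⟩
    have h2 : z.1 (QuotientGroup.mk x : H ⧸ V).out = z'.1 (QuotientGroup.mk x : H ⧸ V).out :=
      congrFun hq _
    rw [hx, hcoc, hcoc, h2, h1]
  ------------------------------------------------------------------
  -- (F5) assembly
  haveI : Finite Idx := inferInstance
  have hTfin : (unramifiedHoms U Q (∅ : Set (HeightOneSpectrum (𝓞 K))) ×ˢ
      ((Set.univ : Set ((H ⧸ V) → M)) ×ˢ Set.univ.pi fun idx ↦ Set.range (cob idx))).Finite :=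
    hQfin.prod (Set.finite_univ.prod (Set.Finite.pi fun idx ↦ Set.finite_range (cob idx)))
  have hΘsub : Θ '' Z0 ⊆ unramifiedHoms U Q (∅ : Set (HeightOneSpectrum (𝓞 K))) ×ˢ
      ((Set.univ : Set ((H ⧸ V) → M)) ×ˢ Set.univ.pi fun idx ↦ Set.range (cob idx)) := by
    rintro _ ⟨z, hz, rfl⟩
    exact ⟨hF1 z hz, Set.mem_univ _, hF2 z hz⟩
  have hΘfin : (Θ '' Z0).Finite := hTfin.subset hΘsub
  -- the image of `z ↦ (Θ z, Λ z)` on `Z0` is finite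
  let F : contOneCocycles (discreteTopRep H M) → ((U → Q) × ((H ⧸ V) → M) × (Idx → H → M)) × (U → M) :=
    fun z ↦ (Θ z, Λ z)
  have hFimg : (F '' Z0).Finite := by
    have hcover : F '' Z0 ⊆ ⋃ θ ∈ Θ '' Z0, F '' (Z0 ∩ {z | Θ z = θ}) := by
      rintro _ ⟨z, hz, rfl⟩
      exact Set.mem_biUnion ⟨z, hz, rfl⟩ ⟨z, ⟨hz, rfl⟩, rfl⟩
    refine (hΘfin.biUnion fun θ hθ ↦ ?_).subset hcover
    obtain ⟨z₀, hz₀, rfl⟩ := hθ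
    have hsub : F '' (Z0 ∩ {z | Θ z = Θ z₀}) ⊆
        (fun f : U → M ↦ (Θ z₀, fun u ↦ Λ z₀ u + f u)) ''
          {f ∈ unramifiedHoms U M (∅ : Set (HeightOneSpectrum (𝓞 K))) | ∀ u, π (f u) = 0} := by
      rintro _ ⟨z, ⟨hz, hzθ⟩, rfl⟩
      refine ⟨fun u ↦ Λ z u - Λ z₀ u, hF3 z hz z₀ hz₀ hzθ, ?_⟩
      show (Θ z₀, fun u ↦ Λ z₀ u + (Λ z u - Λ z₀ u)) = (Θ z, Λ z)
      rw [(hzθ : Θ z = Θ z₀)]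
      congr 1
      funext u
      abel
    exact (hCfin.image _).subset hsub
  have hZ0fin : Z0.Finite :=
    Set.Finite.of_finite_image hFimg fun z _ z' _ hzz' ↦ hF4 (by
      have hΛ : Λ z = Λ z' := congrArg Prod.snd hzz'
      have hq : qv z = qv z' := congrArg (fun t ↦ t.1.2.1) hzz'
      exact Prod.ext hΛ hq)
  -- every class is represented
  have hsub : (fineSelmerInfty M κ : Set (subgroupH1 H M)) ⊆
      oneCocycleClass (discreteTopRep H M) '' Z0 := by
    intro x hx
    obtain ⟨z, rfl⟩ := oneCocycleClass_surjective _ x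
    exact ⟨z, hx, rfl⟩
  exact (hZ0fin.image _).subset hsub

end Main

end Literature.NumberTheory.EllipticCurves.FineSelmerDevissage

end
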